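import Literature.MathematicalPhysics.QuantumLattice.LatticeGaugeDLRProofs
import HarnessLib

/-!
# Clause (i) of the `IR` line `af-pincer-Uc`: GAUGE COVARIANCE of the influence (L3)

Helper module for item `stmt-QuantumFields-19354` (crux `IR`, spine route `BalabanLadder`; slot «af-pincer-Uc»
7eb42365f8aba369; `--supports`, closes nothing).  Companion of `Theorems/BalabanLadderIRClauseILocality` ((L1) rim
reduction, (L2) monotonicity), row «ClauseI LOCALITY & MONOTONICITY» named by the line's lead prover.

`FixedMesh.ClauseI` compares the kernel means `∫ f dγ_Λ(· | σ)`, `∫ f dγ_Λ(· | σ')` of cylinders `f` of the centre cell for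
exterior pairs `(σ, σ')`.  Here (under `[SecondCountableTopology G]`, the binder of the tree's kernel covariance
`ymSpecification_map_gaugeTransformZd_holds`): a gauge transformation trivial at both endpoints of every edge of the test's
support does not move the kernel mean (`integral_ymSpecification_gaugeTransformZd_of_eq_one`), so the influence
`∫ f dγ_Λ(σ) − ∫ f dγ_Λ(σ')` is unchanged under INDEPENDENT such gauges on `σ` and `σ'` (`influence_gauge_invariant`) —
clause (i)'s exterior pairs may be taken modulo gauges trivial near the centre cell; a COMMON gauge moreover preserves
ClauseI's agreement clause (`agree_gaugeTransformZd`) and, for gauge-invariant classes, its typicality clause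
(`typical_gaugeTransformZd_iff`).

Pure specification bookkeeping (Seiler LNP 159 Ch. 2: gauge covariance of the Wilson specification).  No research content;
clause (i) itself is NOT claimed.  Conditional chain untouched; not a gap, not Clay.  No `sorry`;
axioms ⊆ {propext, Classical.choice, Quot.sound}.
-/

set_option autoImplicit false

noncomputable section

open MeasureTheory
open Literature.MathematicalPhysics.QuantumLattice
open Literature.Probability.LatticeModels

namespace Summit.QuantumFields.YangMills.Cruxes.IR.FixedMesh

/-! ## (L3) Gauge covariance of the influence of clause (i) -/

section Gauge

variable {d N : ℕ} {G : Type*} [Group G] [TopologicalSpace G] [IsTopologicalGroup G] [CompactSpace G]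
  [MeasurableSpace G] [BorelSpace G] [SecondCountableTopology G] (ρ : G →* Matrix (Fin N) (Fin N) ℂ)

omit [TopologicalSpace G] [IsTopologicalGroup G] [CompactSpace G] [MeasurableSpace G] [BorelSpace G]
  [SecondCountableTopology G] in
/-- A gauge transformation trivial at both endpoints of every edge of `S₀` fixes every cylinder of `S₀`. -/
theorem cylinder_gaugeTransformZd_of_eq_one {α : Type*} {f : LGConfig d G → α} {S₀ : Finset (ZdEdge d)}
    (hf : IsCylinder f S₀) {g : Site d → G} (hg : ∀ e ∈ S₀, g e.1 = 1 ∧ g (e.1 + Pi.single e.2 1) = 1)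
    (U : LGConfig d G) : f (gaugeTransformZd g U) = f U :=
  hf fun e he => by
    have h := hg e (Finset.mem_coe.1 he)
    simp [gaugeTransformZd, h.1, h.2]

/-- **Gauge transformations trivial near the test do not move the kernel mean.**  For a measurable cylinder `f` of `S₀`
and a gauge transformation `g` with `g = 1` at both endpoints of every edge of `S₀`:
`∫ f dγ_Λ(· | σ^g) = ∫ f dγ_Λ(· | σ)` (kernel covariance `ymSpecification_map_gaugeTransformZd_holds` and `f ∘ g = f`).
[folklore] -/
theorem integral_ymSpecification_gaugeTransformZd_of_eq_one (hρ : Continuous ρ) (β : ℝ) (Λ : Finset (ZdEdge d))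
    {f : LGConfig d G → ℝ} (hfm : Measurable f) {S₀ : Finset (ZdEdge d)} (hf : IsCylinder f S₀)
    {g : Site d → G} (hg : ∀ e ∈ S₀, g e.1 = 1 ∧ g (e.1 + Pi.single e.2 1) = 1) (σ : LGConfig d G) :
    ∫ U, f U ∂(ymSpecification ρ β Λ (gaugeTransformZd g σ)) = ∫ U, f U ∂(ymSpecification ρ β Λ σ) := by
  rw [← ymSpecification_map_gaugeTransformZd_holds ρ hρ β Λ σ g,
    integral_map (measurable_gaugeTransformZd g).aemeasurable hfm.aestronglyMeasurable]
  simp only [cylinder_gaugeTransformZd_of_eq_one hf hg]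

/-- **(L3) The influence of clause (i) is invariant under INDEPENDENT local gauges.**  For gauge transformations
`g, g'`, each trivial at the endpoints of the edges of `S₀` (for clause (i): of the centre cell), the boundary-condition
difference of the kernel means of a measurable cylinder `f` of `S₀` is the same for `(σ^g, σ'^{g'})` as for `(σ, σ')`. -/
theorem influence_gauge_invariant (hρ : Continuous ρ) (β : ℝ) (Λ : Finset (ZdEdge d)) {f : LGConfig d G → ℝ}
    (hfm : Measurable f) {S₀ : Finset (ZdEdge d)} (hf : IsCylinder f S₀) {g g' : Site d → G}
    (hg : ∀ e ∈ S₀, g e.1 = 1 ∧ g (e.1 + Pi.single e.2 1) = 1)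
    (hg' : ∀ e ∈ S₀, g' e.1 = 1 ∧ g' (e.1 + Pi.single e.2 1) = 1) (σ σ' : LGConfig d G) :
    (∫ U, f U ∂(ymSpecification ρ β Λ (gaugeTransformZd g σ))) -
        ∫ U, f U ∂(ymSpecification ρ β Λ (gaugeTransformZd g' σ')) =
      (∫ U, f U ∂(ymSpecification ρ β Λ σ)) - ∫ U, f U ∂(ymSpecification ρ β Λ σ') := by
  rw [integral_ymSpecification_gaugeTransformZd_of_eq_one ρ hρ β Λ hfm hf hg,
    integral_ymSpecification_gaugeTransformZd_of_eq_one ρ hρ β Λ hfm hf hg']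

omit [TopologicalSpace G] [IsTopologicalGroup G] [CompactSpace G] [MeasurableSpace G] [BorelSpace G]
  [SecondCountableTopology G] in
/-- A COMMON gauge transformation preserves agreement of two data on any edge set (ClauseI's agreement clause). -/
theorem agree_gaugeTransformZd {T : Finset (ZdEdge d)} {σ σ' : LGConfig d G} (h : ∀ e ∈ T, σ e = σ' e)
    (g : Site d → G) : ∀ e ∈ T, gaugeTransformZd g σ e = gaugeTransformZd g σ' e := fun e he => by
  simp only [gaugeTransformZd, h e he]

omit [TopologicalSpace G] [IsTopologicalGroup G] [CompactSpace G] [MeasurableSpace G] [BorelSpace G]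
  [SecondCountableTopology G] in
/-- A gauge-invariant class (ClauseI's typicality clause for gauge-invariant `Typ c`) is blind to gauge transformations of
the datum. -/
theorem typical_gaugeTransformZd_iff {T : Set (LGConfig d G)} (hT : IsZdGaugeInvariant fun U => U ∈ T)
    (g : Site d → G) (σ : LGConfig d G) : gaugeTransformZd g σ ∈ T ↔ σ ∈ T := by
  have h : (gaugeTransformZd g σ ∈ T) = (σ ∈ T) := hT g σ
  rw [h]

end Gauge

end Summit.QuantumFields.YangMills.Cruxes.IR.FixedMesh

end
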